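import Summits.Ventures.LatticeQCDFlow.Scaling.SectorExactWitness
import Summits.Ventures.LatticeQCDFlow.Scaling.TightSectorKLogKLaw

/-!
HONEST FRAMING: exact (Metropolis-corrected) sampling algorithms for lattice gauge theory; figures
of merit are autocorrelation/cost numbers at stated couplings and volumes; no continuum-physics
claim.

# SectorExactWitnessTwoSided — THE GENERAL-`S` QUALITY-`p` INSTANCE, BOTH SIDES: CHAPTER O'S `log K` FLOOR WITH THE QUALITY (O8, GENERAL `S`)
# AND CHAPTER Q'S VOLUME-FREE CEILING MEET ON IT —
# `(m/(t·ĉ·p))·log((K+1)(1−ε−K·ν(A))) ≤ t_mix(ε) ≤ ⌈((2t+h)/(th·min{pc/m, 1/(K+1)}))·log(2(1 + K(2t+h)/(2t))/ε)⌉`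
# FOR EVERY FINITE `S`, EVERY POSITIVE LAW `ν` AND EVERY RARE SECTOR `A` — `Θ((K/p)·log K)` WITH NOTHING OF `|S|` OR `ν` (lean-2 GEN-30, ours)

Venture-side (OURS).  Cell `lqcd-flow` (pub-lqcd), unit `pub-lqcd-lean-2-g30`, 2026-08-28.  Chapter Q (item 1 for sector-exact maps on a general
`S`), file 9.  The instance of `Scaling/SectorExactWitness` (cold laws `ν`, hot law `ν` with the sector `A` starved by `p`, `Z = 1 − (1−p)ν(A)`,
identity maps, idle cold replicas, exact hot redraws) is a tight sector in the sense of chapter O: pointwise tightness `μ_0 ≤ (p/Z)·μ_l` on `A`,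
light-side ratio `μ_l ≤ Z·μ_0` off `A` (so `p'q' = p`), sector-idle cold replicas, cold mass `ν(A)` of `A` at every level; O8's general-`S` floor
(`Scaling/TightSectorKLogKLaw`, `dominatedStar_mixingTime_ge_klogk`) therefore applies from the planted start (every cold replica in `A`).

## What is proved

* `sectorWitness_tight` (the chapter-O hypotheses on the instance), **`sectorWitness_mixingTime_two_sided`** — for every finite `S` with `|S| ≥ 2`,
  positive probability vector `ν`, sector `A` (`A`, `Aᶜ` non-empty), `K ≥ 1`, hub list with multiplicities in `[c, ĉ]`, `c ≥ 1`, `0 < t < 1`, `w_0 > 0`,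
  `0 < p ≤ 1`, `0 < ε`, `ε + K·ν(A) < 1`:
  **`(m/(t·ĉ·p))·log((K+1)(1−ε−K·ν(A))) ≤ t_mix(ε) ≤ ⌈((2t+h)/(th·min{pc/m, 1/(K+1)}))·log(2(1 + K(2t+h)/(2t))/ε)⌉`**.

Reading (no numerics implied): at uniform listing `m = cK = ĉK` the two sides are `(K/(tp))·log((K+1)(1−ε−Kν(A)))` and
`≈ ((2t+h)/(th))·(K/p)·log(K/ε)`: on ANY finite landscape the persistent hub of a quality-`p` sector-exact flow has cold-start law `Θ((K/p) log K)`
from both sides, with no trace of `|S|`, `ν` or `ν(A)` in the rate — OPEN-MATH item 1 closed two-sidedly for this family.  NOT CLAIMED: flows inexact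
within a sector; anything measured.  Literature grade (cell rule): OWN (O8 + Q7 assembled); nothing cited as a fact; no new bib keys.
-/

noncomputable section

open Finset Function
open Literature.Probability.MarkovChains

namespace Summit.Ventures.LatticeQCDFlow.Scaling

variable {S : Type*} [Fintype S] [DecidableEq S] {K m : ℕ} {w : Fin (K + 1) → ℝ} {t p Z : ℝ} {ν : S → ℝ}

section SectorWitness2
variable (κ : Fin m → Fin K) (A : Finset S)

/-- **The instance is a tight sector in the sense of chapter O:** reversible kernels, one-sided domination `p`, pointwise tightness `p' = p/Z` on `A`,
light-side ratio `q' = Z` off `A`, sector-idle cold replicas, cold mass `ν(A)`. [ours] -/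
theorem sectorWitness_tight (hν : ∀ u, 0 < ν u) (hν1 : ∑ u, ν u = 1) (hp0 : 0 < p) (hp1 : p ≤ 1) (hAne : A.Nonempty) (hAc : ∃ u, u ∉ A)
    (hZ : Z = ∑ u, ν u * (if u ∈ A then p else 1)) :
    (∀ k : Fin (K + 1), DetailedBalance
        ((fun (k : Fin (K + 1)) (u : S) => if k = 0 then ν u * (if u ∈ A then p else 1) / Z else ν u) k)
        ((fun (k : Fin (K + 1)) (u v : S) => if k = 0 then ν v * (if v ∈ A then p else 1) / Z else (if u = v then (1 : ℝ) else 0)) k))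
    ∧ (∀ (r : Fin m), ∀ z ∈ A, (fun (k : Fin (K + 1)) (u : S) => if k = 0 then ν u * (if u ∈ A then p else 1) / Z else ν u) 0
          (((fun _ : Fin m => Equiv.refl S) r).symm z)
        ≤ p / Z * (fun (k : Fin (K + 1)) (u : S) => if k = 0 then ν u * (if u ∈ A then p else 1) / Z else ν u) (κ r).succ z)
    ∧ (∀ (r : Fin m), ∀ u ∉ A, (fun (k : Fin (K + 1)) (u : S) => if k = 0 then ν u * (if u ∈ A then p else 1) / Z else ν u) (κ r).succ
          ((fun _ : Fin m => Equiv.refl S) r u)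
        ≤ Z * (fun (k : Fin (K + 1)) (u : S) => if k = 0 then ν u * (if u ∈ A then p else 1) / Z else ν u) 0 u)
    ∧ (∀ k : Fin (K + 1), k ≠ 0 → w k * edgeMeasure
          ((fun (k : Fin (K + 1)) (u : S) => if k = 0 then ν u * (if u ∈ A then p else 1) / Z else ν u) k)
          ((fun (k : Fin (K + 1)) (u v : S) => if k = 0 then ν v * (if v ∈ A then p else 1) / Z else (if u = v then (1 : ℝ) else 0)) k)
          A Aᶜ = 0)
    ∧ (∀ k : Fin K, ∑ u ∈ A, (fun (k : Fin (K + 1)) (u : S) => if k = 0 then ν u * (if u ∈ A then p else 1) / Z else ν u) k.succ u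
        ≤ ∑ u ∈ A, ν u) := by
  obtain ⟨hZ0, hZ1, -⟩ := sectorWitness_basic κ A (K := K) hν hν1 hp0 hp1 hAne hAc hZ
  refine ⟨fun k => ?_, fun r z hz => ?_, fun r u hu => ?_, fun k hk => ?_, fun k => ?_⟩
  · intro u v
    dsimp only
    by_cases hk : k = 0
    · simp only [hk, if_true]; ring
    · simp only [hk, if_false]
      by_cases huv : u = v
      · subst huv; rfl
      · rw [if_neg huv, if_neg (Ne.symm huv), mul_zero, mul_zero]
  · dsimp only
    simp only [if_true, Fin.succ_ne_zero, if_false, Equiv.refl_symm, Equiv.refl_apply, if_pos hz]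
    rw [div_mul_eq_mul_div, le_div_iff₀ hZ0, div_mul_cancel₀ _ hZ0.ne']
    nlinarith [hν z]
  · dsimp only
    simp only [if_true, Fin.succ_ne_zero, if_false, Equiv.refl_apply, if_neg hu, mul_one]
    rw [mul_div_cancel₀ _ hZ0.ne']
  · dsimp only
    simp only [hk, if_false]
    have : edgeMeasure (fun u : S => ν u) (fun u v : S => if u = v then (1 : ℝ) else 0) A Aᶜ = 0 := by
      unfold edgeMeasure
      refine Finset.sum_eq_zero fun x hx => Finset.sum_eq_zero fun y hy => ?_
      have hxy : x ≠ y := fun h => (Finset.mem_compl.mp hy) (h ▸ hx)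
      dsimp only
      rw [if_neg hxy, mul_zero]
    rw [this, mul_zero]
  · dsimp only
    simp only [Fin.succ_ne_zero, if_false]
    exact le_rfl

/-- **THE GENERAL-`S` QUALITY-`p` INSTANCE, BOTH SIDES:**
**`(m/(t·ĉ·p))·log((K+1)(1−ε−K·ν(A))) ≤ t_mix(ε) ≤ ⌈((2t+h)/(th·min{pc/m, 1/(K+1)}))·log(2(1 + K(2t+h)/(2t))/ε)⌉`**. [ours] -/
theorem sectorWitness_mixingTime_two_sided [Nontrivial S] (hK : 1 ≤ K) (hm : 1 ≤ m) (ht0 : 0 < t) (ht1 : t < 1) (hw0 : ∀ k, 0 ≤ w k)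
    (hw00 : 0 < w 0) (hw1 : ∑ k, w k = 1) (hν : ∀ u, 0 < ν u) (hν1 : ∑ u, ν u = 1) (hp0 : 0 < p) (hp1 : p ≤ 1) (hAne : A.Nonempty)
    (hAc : ∃ u, u ∉ A) (hZ : Z = ∑ u, ν u * (if u ∈ A then p else 1))
    {c : ℕ} (hc1 : 1 ≤ c) (hc : ∀ p' : Fin K, c ≤ (univ.filter (fun r : Fin m => κ r = p')).card)
    {cmax : ℕ} (hcmax : ∀ k : Fin K, (univ.filter (fun r : Fin m => κ r = k)).card ≤ cmax)
    {ε : ℝ} (hε0 : 0 < ε) (hε : ε + K * ∑ u ∈ A, ν u < 1) :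
    m / (t * cmax * p) * Real.log (((K : ℝ) + 1) * (1 - ε - K * ∑ u ∈ A, ν u))
      ≤ (mixingTime (fun y z : Fin (K + 1) → S =>
          t * ptGraphSwap (fun (k : Fin (K + 1)) (u : S) => if k = 0 then ν u * (if u ∈ A then p else 1) / Z else ν u)
              (fun r : Fin m => (((0 : Fin (K + 1)), (κ r).succ) : Fin (K + 1) × Fin (K + 1))) (fun _ : Fin m => Equiv.refl S) y z
            + (1 - t) * prodKernel w (fun (k : Fin (K + 1)) (u v : S) =>
                if k = 0 then ν v * (if v ∈ A then p else 1) / Z else (if u = v then (1 : ℝ) else 0)) y z)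
          (tensorFun (fun (k : Fin (K + 1)) (u : S) => if k = 0 then ν u * (if u ∈ A then p else 1) / Z else ν u)) ε : ℝ)
    ∧ mixingTime (fun y z : Fin (K + 1) → S =>
          t * ptGraphSwap (fun (k : Fin (K + 1)) (u : S) => if k = 0 then ν u * (if u ∈ A then p else 1) / Z else ν u)
              (fun r : Fin m => (((0 : Fin (K + 1)), (κ r).succ) : Fin (K + 1) × Fin (K + 1))) (fun _ : Fin m => Equiv.refl S) y z
            + (1 - t) * prodKernel w (fun (k : Fin (K + 1)) (u v : S) =>
                if k = 0 then ν v * (if v ∈ A then p else 1) / Z else (if u = v then (1 : ℝ) else 0)) y z)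
          (tensorFun (fun (k : Fin (K + 1)) (u : S) => if k = 0 then ν u * (if u ∈ A then p else 1) / Z else ν u)) ε
      ≤ ⌈1 / (t * ((1 - t) * w 0) / (2 * t + (1 - t) * w 0) * min (p * c / m) (1 / (K + 1)))
          * Real.log (2 * (1 + K * (2 * t + (1 - t) * w 0) / (2 * t)) / ε)⌉₊ := by
  refine ⟨?_, sectorWitness_mixingTime_le κ A hm ht0 ht1 hw0 hw00 hw1 hν hν1 hp0 hp1 hAne hAc hZ hc1 hc hε0⟩
  obtain ⟨hZ0, hZ1, hμ, hμ1, -, -, hM, -, -⟩ := sectorWitness_basic κ A (K := K) hν hν1 hp0 hp1 hAne hAc hZ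
  obtain ⟨hMrev, htight, hlight, hidle, hθ⟩ := sectorWitness_tight κ A (K := K) (w := w) hν hν1 hp0 hp1 hAne hAc hZ
  have hM0 : ∀ u v : S, (fun (k : Fin (K + 1)) (u v : S) =>
      if k = 0 then ν v * (if v ∈ A then p else 1) / Z else (if u = v then (1 : ℝ) else 0)) 0 u v
      = (fun (k : Fin (K + 1)) (u : S) => if k = 0 then ν u * (if u ∈ A then p else 1) / Z else ν u) 0 v := by
    intro u v; simp only [if_true]
  have hdom := sectorWitness_oneSided κ A (K := K) hν hν1 hp0 hp1 hAne hAc hZ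
  have hφA : ∀ (r : Fin m) (u : S), (fun _ : Fin m => Equiv.refl S) r u ∈ A ↔ u ∈ A := fun r u => Iff.rfl
  obtain ⟨a0, ha0⟩ := hAne
  have h := dominatedStar_mixingTime_ge_klogk κ (fun _ : Fin m => Equiv.refl S) hK hm ht0 ht1 hw0 hw00 hw1 hμ hμ1 hM hMrev hM0 hp0 hp1
    hdom hc1 hc hcmax hφA (div_pos hp0 hZ0) hZ0 htight hlight hidle hθ (fun _ => a0) (fun _ => ha0) hε0 hε
  have hcoef : (m : ℝ) / (t * cmax * (p / Z) * Z) = m / (t * cmax * p) := by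
    congr 1; field_simp
  rw [hcoef] at h
  exact h

end SectorWitness2

end Summit.Ventures.LatticeQCDFlow.Scaling

end
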